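import Summits.RiemannHypothesis.RiemannHypothesis.Theorems.WeilTwoPrimeDeflC83XBase
import Literature.NumberTheory.LFunctions.WeilBlockRows
import HarnessLib

/-!
# Deflated two-prime certificate C83X: rows 32–39 of the even check `D C = I`

`WeilCert.checkDCRow 0` for certificate C83X, by `decide +kernel`. Pure proof file.
-/

set_option linter.dupNamespace false

noncomputable section

namespace Summit.RiemannHypothesis.RiemannHypothesis.Theorems.EvenWinsBeyondArch

open Literature.NumberTheory.LFunctions

set_option maxHeartbeats 0 in
/-- Kernel check of row 32 of the even `D C = I` (certificate C83X). [folklore] -/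
theorem checkDCRow0_32_weilCertDeflC83X : weilCertDeflC83XBase.checkDCRow 0 32 = true := by
  decide +kernel

set_option maxHeartbeats 0 in
/-- Kernel check of row 33 of the even `D C = I` (certificate C83X). [folklore] -/
theorem checkDCRow0_33_weilCertDeflC83X : weilCertDeflC83XBase.checkDCRow 0 33 = true := by
  decide +kernel

set_option maxHeartbeats 0 in
/-- Kernel check of row 34 of the even `D C = I` (certificate C83X). [folklore] -/
theorem checkDCRow0_34_weilCertDeflC83X : weilCertDeflC83XBase.checkDCRow 0 34 = true := by
  decide +kernel

set_option maxHeartbeats 0 in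
/-- Kernel check of row 35 of the even `D C = I` (certificate C83X). [folklore] -/
theorem checkDCRow0_35_weilCertDeflC83X : weilCertDeflC83XBase.checkDCRow 0 35 = true := by
  decide +kernel

set_option maxHeartbeats 0 in
/-- Kernel check of row 36 of the even `D C = I` (certificate C83X). [folklore] -/
theorem checkDCRow0_36_weilCertDeflC83X : weilCertDeflC83XBase.checkDCRow 0 36 = true := by
  decide +kernel

set_option maxHeartbeats 0 in
/-- Kernel check of row 37 of the even `D C = I` (certificate C83X). [folklore] -/
theorem checkDCRow0_37_weilCertDeflC83X : weilCertDeflC83XBase.checkDCRow 0 37 = true := by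
  decide +kernel

set_option maxHeartbeats 0 in
/-- Kernel check of row 38 of the even `D C = I` (certificate C83X). [folklore] -/
theorem checkDCRow0_38_weilCertDeflC83X : weilCertDeflC83XBase.checkDCRow 0 38 = true := by
  decide +kernel

set_option maxHeartbeats 0 in
/-- Kernel check of row 39 of the even `D C = I` (certificate C83X). [folklore] -/
theorem checkDCRow0_39_weilCertDeflC83X : weilCertDeflC83XBase.checkDCRow 0 39 = true := by
  decide +kernel


end Summit.RiemannHypothesis.RiemannHypothesis.Theorems.EvenWinsBeyondArch
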